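import Summits.QuantumFields.YangMills.Theorems.BalabanUVNodesN14SourceTowerOfRecordSpine
import Literature.MathematicalPhysics.QuantumFieldTheory.Balaban1983to89.B15Claim189UnitTestAtRecord

/-!
# DAG node N14 · NE1′ — AT THE DATUM OF RECORD THE N14 OBJECT OF RECORD **IS** THE UNIT-SCALE MODEL PIN: `ne1OfRecord l₀ Λ F θ hP g₀ os = ne1UnitScale l₀ 1 Λ`,
# `obsSupNorm = 1` at EVERY cutoff, and `Ne1PinnedOfRecord 𝔯 ↔ (𝔯.ne1 = ne1UnitScale l₀ 1 Λ)` — the «model» pin at `M = 1` and the «object» pin are the same pin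

Cell `pub-ymgap`, YM-PLAN Track A (HUMAN RULING D-0062 ∕ D-0149, director-ym №197), width seat `pub-ymgap-dag-n14-w1` (generation 2), FILE 5 of the seat.
THEOREMS ONLY (0 `def`); imports FILE 4 `BalabanUVNodesN14SourceTowerOfRecordSpine` (p594469) and dag-n12-e's Literature module `B15Claim189UnitTestAtRecord` ONLY; modifies
nothing; `--supports` K3⁷ `SpineGivenEndpointR13SepCoPH` (stmt-QuantumFields-20544) `--as helper` — COUNT-NEUTRAL.

WHY (located; bears on plan g80∕g81's (w14′) «MODEL-LEVEL inhabitant (N14 `ne1UnitScale`) vs an N14 object of record WITH datum content»).  FILE 3 typed the object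
`ne1OfRecord l₀ Λ F θ hP g₀ os` — the source tower whose one insertion is the dressed exponent `t·F_K`, `F_K = prodObs ((datumOfRecord₁₃CoPH F N θ hP).scheme g₀) K os`,
booked with its sup-size `|t| · sup_U |F_K U|` — and proved the sup-size `= 1` at cutoff `0` only.  AT THE DATUM OF RECORD it is `1` at EVERY cutoff, by a COMPUTATION:
the datum's averaging IS def-R's `Node00.avOfRecord` (`rfl`) = Bałaban's block averaging with the printed `exp[mean log]` on `SU(N)` ([Balaban1987RG1] (0.4)), which maps
the unit configuration to the unit configuration at every level (dag-n12-e's `B15Claim189UnitTestAtRecord.iter_avOfRecord_one`, from the 3D programme's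
`T3DescentFibreTower.avgFun_one` ∕ `expMeanLogSU_E_one`); so every unit-lattice averaged Wilson loop ATTAINS `1` at `U ≡ 1` while `|avgObs| ≤ 1`.  Hence the booked size is
EXACTLY `|t|` and the object of record COINCIDES with FILE 1's model `ne1UnitScale l₀ 1 Λ` (p584515) as an element of `NE1pCarriers`.  Consequences: FILE 3's pin shape
`Ne1PinnedOfRecord 𝔯` is EQUIVALENT to «`𝔯.ne1` is the `M = 1` unit-scale assignment for some `l₀ > 0`, `Λ ≥ 0`»; g0's `readingUnitScale lit l₀ 1 Λ` and dag-n27-c's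
`…UnitScaleN14` leaves at `M = 1` are ALREADY at the object of record; the budget `l₀` of reading (a) is saturated.

* §1 [datum content, every cutoff] `av_datumOfRecord₁₃CoPH` (`rfl`) · `iter_av_one_datumOfRecord₁₃CoPH` · `avgObs_one_datumOfRecord₁₃CoPH` · `prodObs_one_datumOfRecord₁₃CoPH` ·
  ★ `obsSupNorm_datumOfRecord₁₃CoPH` (`= 1`).
* §2 [the identification] `unitScaleTowerK_congr` · `size_ne1OfRecord_eq_abs` · ★★ `sourceTowerOfRecord_datumOfRecord₁₃CoPH_eq_sourceTower` · ★★ `ne1OfRecord_eq_ne1UnitScale` ·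
  `ne1OfRecordFree_eq_ne1UnitScale`.
* §3 [pin level] ★ `ne1PinnedOfRecord_iff_unitScale` · `ne1PinnedOfRecord_of_eq_unitScale` · `ne1PinnedOfRecord_readingUnitScale`.
* §4 [spine, read through the identification] `schemeZ_div_le_exp_abs_datumOfRecord₁₃CoPH` · `exp_neg_abs_le_schemeZ_div_datumOfRecord₁₃CoPH` ·
  `abs_genFun_le_abs_datumOfRecord₁₃CoPH` (= U6's `abs_genFun_schemeZ_le` recovered BY NAME through the tower — a consistency check, nothing new).

HONEST FRAMING.  A COMPUTATION at the datum of record (printed averaging fixes `U ≡ 1`; normalized traces) plus bookkeeping; it IDENTIFIES two already-landed N14 pins and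
proves no estimate of Bałaban's run below the unit lattice.  Reading (a) is the director's ADOPTED TABLE READING; N14 NOT discharged (the chair books after acts (i)–(v);
dag-lead's rule on what reading (a)'s pin is worth stands); NE1′ for SUB-UNIT observables NOT PRINTED ([Balaban1989LargeFieldII] (1.73)–(1.75) pp. 379–380 type the action
only) and NOT PROVED; K3⁷ OPEN, not claimed; counts unmoved (typed 28∕28 · discharged 5∕27, A 5∕28).  The Yang–Mills mass gap (Clay) is NOT proved by any of this — R4
closes the conditional finite-𝕋⁴ rung `BalabanLadder.UV` only; NOT ℝ⁴, NOT OS, NOT a mass gap.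
-/

noncomputable section

namespace YMDAG.N14.TopBorn

open Finset
open scoped BigOperators
open Literature.MathematicalPhysics.QuantumFieldTheory.Balaban1983to89
open Literature.MathematicalPhysics.QuantumFieldTheory.Balaban1983to89.T4Continuum
open Literature.MathematicalPhysics.QuantumFieldTheory.Balaban1983to89.T4TermFormat
open Literature.MathematicalPhysics.QuantumFieldTheory.Balaban1983to89.Missing (TorusScheme)
open Literature.MathematicalPhysics.QuantumFieldTheory.Balaban1983to89.T4GenFunBounds (prodObs schemeZ)
open Summit.QuantumFields.BalabanUV.T4Continuum.NE1p.DressedRoot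
open YMDAG.UVSplit
open YMDAG.N14.TowerGuard (Nondegenerate Ne1NondegenerateOn)
open Node00 (Stage13HParams RateObjects₁₁ datumOfRecord₁₃CoPH avOfRecord)

/-! ## §1 Datum content at EVERY cutoff: the printed averaging fixes the unit configuration, so the sup-size is exactly `1` -/

section DatumContent

variable {N : ℕ} [NeZero N] (F : T4Family) (θ : Stage13HParams F N) (hP : θ.Provisos₁₃CoPH F N) (g₀ : ℕ → ℝ)

/-- The datum of record's averaging maps ARE def-R's averaging of record (Bałaban's block averaging with the printed `exp[mean log]` on `SU(N)`; `rfl`). [folklore] -/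
theorem av_datumOfRecord₁₃CoPH : (datumOfRecord₁₃CoPH F N θ hP).av = avOfRecord F N := rfl

/-- **`M^j(1) = 1` AT THE DATUM OF RECORD** [datum content]: the `j`-fold averaged unit configuration of the `K`-th torus is the unit configuration (dag-n12-e's
`B15Claim189UnitTestAtRecord.iter_avOfRecord_one` BY NAME). [folklore] -/
theorem iter_av_one_datumOfRecord₁₃CoPH (K j : ℕ) :
    Averaging.iter ((datumOfRecord₁₃CoPH F N θ hP).av K) j (1 : GaugeField (F.P K) 0 (SU N)) = 1 :=
  B15Claim189UnitTestAtRecord.iter_avOfRecord_one F N K j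

/-- **EVERY UNIT-LATTICE AVERAGED WILSON LOOP OF THE DATUM OF RECORD IS `1` AT THE UNIT CONFIGURATION, EVERY CUTOFF** [datum content] (`holAt 1 = 1`, `reTr_one`). [folklore] -/
theorem avgObs_one_datumOfRecord₁₃CoPH (K : ℕ) (C : ULoop F) : (datumOfRecord₁₃CoPH F N θ hP).avgObs K C 1 = 1 := by
  show GaugeGroup.reTr (holAt (Averaging.iter ((datumOfRecord₁₃CoPH F N θ hP).av K) K (1 : GaugeField (F.P K) 0 (SU N))) (C.1.atLevel K)) = 1
  rw [iter_av_one_datumOfRecord₁₃CoPH, T3DescentFibreTower.holAt_one, GaugeGroup.reTr_one]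

/-- … hence the product observable of every string is `1` at the unit configuration, every cutoff. [folklore] -/
theorem prodObs_one_datumOfRecord₁₃CoPH (K : ℕ) (os : List (ULoop F)) : prodObs ((datumOfRecord₁₃CoPH F N θ hP).scheme g₀) K os 1 = 1 := by
  show (os.map fun o => (datumOfRecord₁₃CoPH F N θ hP).avgObs K o 1).prod = 1
  apply List.prod_eq_one
  intro x hx
  obtain ⟨o, -, rfl⟩ := List.mem_map.mp hx
  exact avgObs_one_datumOfRecord₁₃CoPH F θ hP K o

/-- **THE SUP-SIZE OF THE RECORD's PRODUCT OBSERVABLE IS EXACTLY `1` AT EVERY CUTOFF** [datum content] (attained at `U ≡ 1`; `≤ 1` by normalized traces). [folklore] -/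
theorem obsSupNorm_datumOfRecord₁₃CoPH (K : ℕ) (os : List (ULoop F)) : obsSupNorm ((datumOfRecord₁₃CoPH F N θ hP).scheme g₀) K os = 1 :=
  obsSupNorm_eq_one_of_abs_eq_one _ (fun K C U => (datumOfRecord₁₃CoPH F N θ hP).abs_avgObs_le_one K C U) K os 1
    (by rw [prodObs_one_datumOfRecord₁₃CoPH, abs_one])

end DatumContent

/-! ## §2 The identification: the object of record IS the unit-scale model with observable bound `1` -/

section Identification

/-- Towers with cutoff-dependent sizes agree when their size arrays agree (`subst`; the nonnegativity proofs are irrelevant). [folklore] -/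
theorem unitScaleTowerK_congr {P : Type} (ι : Type) [Fintype ι] {a a' : P → ℕ → ι → ℝ} (ha : ∀ p K i, 0 ≤ a p K i) (ha' : ∀ p K i, 0 ≤ a' p K i)
    (h : a = a') : unitScaleTowerK ι a ha = unitScaleTowerK ι a' ha' := by
  subst h
  rfl

variable {N : ℕ} [NeZero N] {l₀ Λ : ℝ} (F : T4Family) (θ : Stage13HParams F N) (hP : θ.Provisos₁₃CoPH F N) (g₀ : ℕ → ℝ) (os : List (ULoop F))

/-- **THE BOOKED SIZE OF THE OBJECT OF RECORD IS EXACTLY `|t|`** at every cutoff [datum content]. [folklore] -/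
theorem size_ne1OfRecord_eq_abs (t : {t : ℝ // |t| ≤ l₀}) (K : ℕ) (b : Unit) (k : ℕ) :
    ((ne1OfRecord l₀ Λ F θ hP g₀ os).𝒯.B t K).size b k = |t.1| := by
  rw [size_ne1OfRecord, obsSupNorm_datumOfRecord₁₃CoPH, mul_one]

/-- **THE SOURCE TOWER OF THE RECORD's STRING IS FILE 1's SOURCE TOWER WITH OBSERVABLE BOUND `1`** [identification]. [folklore] -/
theorem sourceTowerOfRecord_datumOfRecord₁₃CoPH_eq_sourceTower :
    sourceTowerOfRecord ((datumOfRecord₁₃CoPH F N θ hP).scheme g₀) l₀ os = sourceTower l₀ 1 zero_le_one := by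
  show unitScaleTowerK Unit _ _ = unitScaleTowerK Unit (fun (t : {t : ℝ // |t| ≤ l₀}) _ _ => |t.1| * 1) _
  exact unitScaleTowerK_congr Unit _ _ (funext fun t => funext fun K => funext fun _ => by
    rw [obsSupNorm_datumOfRecord₁₃CoPH])

/-- **THE N14 OBJECT OF RECORD IS THE UNIT-SCALE MODEL PIN** [identification]: `ne1OfRecord l₀ Λ F θ hP g₀ os = ne1UnitScale l₀ 1 Λ _ F θ hP g₀ os` in `NE1pCarriers`,
at EVERY Stage-13 tuple with provisos, every `g₀`, every string. [folklore] -/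
theorem ne1OfRecord_eq_ne1UnitScale : ne1OfRecord l₀ Λ F θ hP g₀ os = ne1UnitScale (N := N) l₀ 1 Λ zero_le_one F θ hP g₀ os := by
  show (⟨{t : ℝ // |t| ≤ l₀}, sourceTowerOfRecord ((datumOfRecord₁₃CoPH F N θ hP).scheme g₀) l₀ os, Λ⟩ : NE1pCarriers) =
    ⟨{t : ℝ // |t| ≤ l₀}, sourceTower l₀ 1 zero_le_one, Λ⟩
  rw [sourceTowerOfRecord_datumOfRecord₁₃CoPH_eq_sourceTower]

/-- … and so is FILE 4's proviso-free door, under the provisos. [folklore] -/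
theorem ne1OfRecordFree_eq_ne1UnitScale : ne1OfRecordFree l₀ Λ F θ g₀ os = ne1UnitScale (N := N) l₀ 1 Λ zero_le_one F θ hP g₀ os := by
  rw [ne1OfRecordFree_eq F θ g₀ os hP, ne1OfRecord_eq_ne1UnitScale]

end Identification

/-! ## §3 Pin level: `Ne1PinnedOfRecord` is the `M = 1` unit-scale pin -/

section Pin

variable {N : ℕ} [NeZero N] (𝔯 : RateReading₁₃CoPH N)

/-- **THE «OBJECT» PIN AND THE «MODEL» PIN AT `M = 1` ARE THE SAME PIN** [identification]: `Ne1PinnedOfRecord 𝔯` iff the reading's `ne1` is FILE 1's unit-scale assignment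
`ne1UnitScale l₀ 1 Λ` for some `l₀ > 0`, `Λ ≥ 0`, at every Stage-13 tuple with provisos. [folklore] -/
theorem ne1PinnedOfRecord_iff_unitScale :
    Ne1PinnedOfRecord 𝔯 ↔ ∃ l₀ Λ : ℝ, 0 < l₀ ∧ 0 ≤ Λ ∧
      ∀ (F : T4Family) (θ : Stage13HParams F N) (hP : θ.Provisos₁₃CoPH F N) (g₀ : ℕ → ℝ) (os : List (ULoop F)),
        𝔯.ne1 F θ hP g₀ os = ne1UnitScale l₀ 1 Λ zero_le_one F θ hP g₀ os := by
  constructor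
  · rintro ⟨l₀, Λ, hl₀, hΛ, h⟩
    exact ⟨l₀, Λ, hl₀, hΛ, fun F θ hP g₀ os => (h F θ hP g₀ os).trans (ne1OfRecord_eq_ne1UnitScale F θ hP g₀ os)⟩
  · rintro ⟨l₀, Λ, hl₀, hΛ, h⟩
    exact ⟨l₀, Λ, hl₀, hΛ, fun F θ hP g₀ os => (h F θ hP g₀ os).trans (ne1OfRecord_eq_ne1UnitScale F θ hP g₀ os).symm⟩

/-- Any reading whose `ne1` is the `M = 1` unit-scale assignment (`l₀ > 0`, `Λ ≥ 0`) carries the pin. [folklore] -/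
theorem ne1PinnedOfRecord_of_eq_unitScale {l₀ Λ : ℝ} (hl₀ : 0 < l₀) (hΛ : 0 ≤ Λ)
    (h : ∀ (F : T4Family) (θ : Stage13HParams F N) (hP : θ.Provisos₁₃CoPH F N) (g₀ : ℕ → ℝ) (os : List (ULoop F)),
      𝔯.ne1 F θ hP g₀ os = ne1UnitScale l₀ 1 Λ zero_le_one F θ hP g₀ os) :
    Ne1PinnedOfRecord 𝔯 :=
  (ne1PinnedOfRecord_iff_unitScale 𝔯).mpr ⟨l₀, Λ, hl₀, hΛ, h⟩

/-- **g0's READING OF RECORD `readingUnitScale lit l₀ 1 Λ` IS PINNED** (FILE 1, p584515; `0 < l₀`, `0 ≤ Λ`) — the K3⁷ v2∕v3 «model» inhabitant of the N14 slot is the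
object of record. [folklore] -/
theorem ne1PinnedOfRecord_readingUnitScale
    (lit : (F : T4Family) → (θ : Stage13HParams F N) → θ.Provisos₁₃CoPH F N → (ℕ → ℝ) → List (ULoop F) → RateObjects₁₁ N)
    {l₀ Λ : ℝ} (hl₀ : 0 < l₀) (hΛ : 0 ≤ Λ) : Ne1PinnedOfRecord (readingUnitScale lit l₀ 1 Λ zero_le_one) :=
  ne1PinnedOfRecord_of_eq_unitScale _ hl₀ hΛ fun _ _ _ _ _ => rfl

end Pin

/-! ## §4 The spine bounds read through the identification (`size = |t|`): U6's inputs recovered BY NAME — a consistency check -/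

section Spine

variable {N : ℕ} [NeZero N] (F : T4Family) (θ : Stage13HParams F N) (hP : θ.Provisos₁₃CoPH F N) (g₀ : ℕ → ℝ) (os : List (ULoop F))

/-- `Z_K(t)∕Z_K(0) ≤ e^{|t|}` at the datum of record (FILE 4 `schemeZ_div_le_exp_size_ne1OfRecord` with `size = |t|`). [folklore] -/
theorem schemeZ_div_le_exp_abs_datumOfRecord₁₃CoPH (K : ℕ) (t : ℝ) :
    schemeZ ((datumOfRecord₁₃CoPH F N θ hP).scheme g₀) os K t / schemeZ ((datumOfRecord₁₃CoPH F N θ hP).scheme g₀) os K 0 ≤ Real.exp |t| := by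
  have h := schemeZ_div_le_exp_size_ne1OfRecord (l₀ := |t|) (Λ := 0) F θ hP g₀ os ⟨t, le_rfl⟩ K () K
  rwa [size_ne1OfRecord_eq_abs] at h

/-- `e^{−|t|} ≤ Z_K(t)∕Z_K(0)` at the datum of record. [folklore] -/
theorem exp_neg_abs_le_schemeZ_div_datumOfRecord₁₃CoPH (K : ℕ) (t : ℝ) :
    Real.exp (-|t|) ≤ schemeZ ((datumOfRecord₁₃CoPH F N θ hP).scheme g₀) os K t / schemeZ ((datumOfRecord₁₃CoPH F N θ hP).scheme g₀) os K 0 := by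
  have h := exp_neg_size_le_schemeZ_div_ne1OfRecord (l₀ := |t|) (Λ := 0) F θ hP g₀ os ⟨t, le_rfl⟩ K () K
  rwa [size_ne1OfRecord_eq_abs] at h

/-- `|G_K(t)| ≤ |t|` at the datum of record — U6's `T4GenFunBounds.abs_genFun_schemeZ_le` recovered through the tower (consistency check). [folklore] -/
theorem abs_genFun_le_abs_datumOfRecord₁₃CoPH (K : ℕ) (t : ℝ) :
    |T4CauchySum.genFun (schemeZ ((datumOfRecord₁₃CoPH F N θ hP).scheme g₀) os) K t| ≤ |t| := by
  have h := abs_genFun_le_size_ne1OfRecord (l₀ := |t|) (Λ := 0) F θ hP g₀ os ⟨t, le_rfl⟩ K () K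
  rwa [size_ne1OfRecord_eq_abs] at h

end Spine

end YMDAG.N14.TopBorn

end
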